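import Summits.CriticalPhenomena.SAWScalingLimit.Theorems.SAWBrickWallHomotopyModulusUniversalityAffineTransport
import Summits.CriticalPhenomena.SAWScalingLimit.Theorems.SAWBrickWallHomotopyModulusUniversalityJitteredDrawing
import Summits.CriticalPhenomena.SAWScalingLimit.Theorems.SAWMassiveIsingTiltHexEndpointApproxExists
import Literature.Probability.LatticeModels.MeshDomainJordan
import Literature.Probability.LatticeModels.SquareTilingCrosscut
import HarnessLib

/-!
# `ModulusUniversality`, line `birth`: disputed sites live in an `o(1)`-collar of `∂E`

Helper file (`--supports stmt-CriticalPhenomena-5790`) of the line `birth` / `registered` for the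
crux `SAWBrickWallHomotopy.ModulusUniversality` (skeleton
`Summits/CriticalPhenomena/SAWScalingLimit/Cruxes/ModulusUniversality/Lines/birth.lean`, reshape 5,
lead c2).  It proves the DETERMINISTIC half of the former stub M2a (`stub_collarNonHitting`):

* `stub_disputedCollar` (registered signature, literal) — **the collar lemma**: for the affinity
  `B = diag(2, 2/√3)`, every Dobrushin domain `E` and every `η > 0`, for all small mesh `δ > 0`,
  every DISPUTED brick-wall site `x = site w` (one whose adjacency to some `site w'` in the `ℤ²`
  discrete domain restricted to brick-wall bonds, `discreteDomainGraph E δ ⊓ SAW.brickWallGraph`,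
  differs from the adjacency of `w, w'` in the jittered honeycomb discrete domain
  `SAW.embDomainGraph hexGraph (B ∘ hexCenter) E δ`) has its mesh point within `η` of `E.carrierᶜ`.
  Proof: in the bulk `{infDist(·, Eᶜ) ≥ η}` both discretisations contain every site with ALL its
  brick-wall bonds once `δ` is small — the `ℤ²` bulk lemma
  `JordanDomain.exists_forall_mem_meshDomain_and_reachable`, its honeycomb twin
  `HexEndpointApprox.exists_forall_mem_hexMeshDomain_and_reachable` for the Jordan domain `B⁻¹E`
  transported by `embMeshDomain_affine`, the closed-segment edge rules (segments of length `≤ 5δ/3`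
  around a bulk point stay in `E`), and the position-compatible dictionary
  `hexGraph_adj_iff_brickWallGraph_adj` with jitter `≤ 2δ/3` (`dist_meshPoint_site_le`).
* `adj_inf_brickWall_iff_of_le_infDist`, `embDomainGraph_adj_iff_of_le_infDist` — the two bulk
  adjacency descriptions it is made of.

All bookkeeping tagged [folklore].  No definitions.
-/

noncomputable section

open MeasureTheory Filter Topology Metric Set
open scoped NNReal ENNReal
open Literature.Probability.LatticeModels
open Literature.Probability.RandomPlanarGeometry

namespace Summit.CriticalPhenomena.SAWScalingLimit.Cruxes.ModulusUniversality.Birth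

/-! ### The affinity `B = diag(2, 2/√3)` -/

/-- `B` is real-homogeneous. [folklore] -/
theorem affinityB_real_mul {B : ℂ ≃ₜ ℂ}
    (hB : ∀ z : ℂ, B z = ((2 * z.re : ℝ) : ℂ) + ((2 / Real.sqrt 3 * z.im : ℝ) : ℂ) * Complex.I)
    (r : ℝ) (z : ℂ) : B ((r : ℂ) * z) = (r : ℂ) * B z := by
  simp only [hB]
  apply Complex.ext
  · simp only [Complex.add_re, Complex.mul_re, Complex.mul_im, Complex.ofReal_re,
      Complex.ofReal_im, Complex.I_re, Complex.I_im, Complex.add_im]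
    ring
  · simp only [Complex.add_re, Complex.mul_re, Complex.mul_im, Complex.ofReal_re,
      Complex.ofReal_im, Complex.I_re, Complex.I_im, Complex.add_im]
    ring

/-- `B` is affine on segments. [folklore] -/
theorem affinityB_lineMap {B : ℂ ≃ₜ ℂ}
    (hB : ∀ z : ℂ, B z = ((2 * z.re : ℝ) : ℂ) + ((2 / Real.sqrt 3 * z.im : ℝ) : ℂ) * Complex.I)
    (x y : ℂ) (c : ℝ) : B (AffineMap.lineMap x y c) = AffineMap.lineMap (B x) (B y) c := by
  rw [AffineMap.lineMap_apply_module', AffineMap.lineMap_apply_module', Complex.real_smul,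
    Complex.real_smul]
  simp only [hB]
  apply Complex.ext
  · simp only [Complex.add_re, Complex.add_im, Complex.sub_re, Complex.sub_im, Complex.mul_re,
      Complex.mul_im, Complex.ofReal_re, Complex.ofReal_im, Complex.I_re, Complex.I_im]
    ring
  · simp only [Complex.add_re, Complex.add_im, Complex.sub_re, Complex.sub_im, Complex.mul_re,
      Complex.mul_im, Complex.ofReal_re, Complex.ofReal_im, Complex.I_re, Complex.I_im]
    ring

/-! ### Metric bookkeeping around a bulk point -/

/-- A point within `r` of a point at distance `≥ η` from `Sᶜ`, with `r ≤ η/2`, is itself at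
distance `≥ η/2` from `Sᶜ`. [folklore] -/
theorem le_infDist_of_dist_le {p q : ℂ} {S : Set ℂ} {η r : ℝ} (hp : η ≤ infDist p Sᶜ)
    (hq : dist q p ≤ r) (hr : r ≤ η / 2) : η / 2 ≤ infDist q Sᶜ := by
  have h := Metric.infDist_le_infDist_add_dist (s := Sᶜ) (x := p) (y := q)
  rw [dist_comm] at h
  linarith

/-- A segment whose endpoints are within `< η` of a point at distance `≥ η` from `Sᶜ` lies in
the closure of `S` (indeed in the open ball, which lies in `S`). [folklore] -/
theorem segment_subset_closure_of_dist_lt {p u v : ℂ} {S : Set ℂ} {η : ℝ}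
    (hp : η ≤ infDist p Sᶜ) (hu : dist u p < η) (hv : dist v p < η) :
    segment ℝ u v ⊆ closure S := by
  have hball : ball p η ⊆ S :=
    (ball_subset_ball hp).trans ball_infDist_compl_subset
  exact ((convex_ball p η).segment_subset (mem_ball.2 hu) (mem_ball.2 hv)).trans
    (hball.trans subset_closure)

/-- The bulk `{z | η/2 ≤ infDist z Eᶜ}` of a Dobrushin domain is a compact subset of it.
[folklore] -/
theorem isCompact_bulk (E : DobrushinDomain) (η : ℝ) (hη : 0 < η) :
    IsCompact {z : ℂ | η / 2 ≤ infDist z E.carrierᶜ} ∧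
      {z : ℂ | η / 2 ≤ infDist z E.carrierᶜ} ⊆ E.carrier := by
  have hsub : {z : ℂ | η / 2 ≤ infDist z E.carrierᶜ} ⊆ E.carrier := fun z hz => by
    by_contra h
    have h0 : infDist z E.carrierᶜ = 0 := infDist_zero_of_mem h
    have hz' : η / 2 ≤ infDist z E.carrierᶜ := hz
    linarith
  exact ⟨Metric.isCompact_of_isClosed_isBounded
    (isClosed_le continuous_const (continuous_infDist_pt _)) (E.isBounded.subset hsub), hsub⟩

/-! ### Bulk adjacency, `ℤ²` conventions -/

/-- **Bulk adjacency of the straight brick wall.**  If every site with mesh point in the bulk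
`{infDist(·, Eᶜ) ≥ η/2}` lies in `meshDomain E δ` (conclusion of the `ℤ²` bulk lemma) and
`0 ≤ δ ≤ η/2`, then at a site `x` with `infDist(δx, Eᶜ) ≥ η` the `ℤ²` discrete domain restricted
to brick-wall bonds has exactly the brick-wall bonds of `x`. [folklore] -/
theorem adj_inf_brickWall_iff_of_le_infDist {E : DobrushinDomain} {δ η : ℝ} (hδ : 0 ≤ δ)
    (hδη : δ ≤ η / 2) (hη : 0 < η)
    (hbulk : ∀ y : Site 2, η / 2 ≤ infDist (meshPoint δ y) E.carrierᶜ → y ∈ meshDomain E.carrier δ)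
    {x : Site 2} (hx : η ≤ infDist (meshPoint δ x) E.carrierᶜ) (y : Site 2) :
    (discreteDomainGraph E.carrier δ ⊓ SAW.brickWallGraph).Adj x y ↔ SAW.brickWallGraph.Adj x y := by
  rw [SimpleGraph.inf_adj]
  refine ⟨fun h => h.2, fun h => ⟨?_, h⟩⟩
  have hzd : (zdGraph 2).Adj x y := SAW.brickWallGraph_le h
  have hdist : dist (meshPoint δ y) (meshPoint δ x) ≤ δ := by
    rw [dist_comm, SquareTiling.dist_meshPoint_adj hδ hzd]
  refine discreteDomainGraph_adj_iff.2 ⟨meshGraph_adj_iff.2 ⟨hzd, ?_⟩, ?_, ?_⟩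
  · exact segment_subset_closure_of_dist_lt hx (by rw [dist_self]; exact hη)
      (by linarith)
  · exact hbulk x (by linarith)
  · exact hbulk y (le_infDist_of_dist_le hx hdist hδη)

/-! ### Bulk adjacency, jittered honeycomb conventions -/

/-- **Bulk adjacency of the jittered honeycomb.**  If every honeycomb vertex whose jittered mesh
point `δ B(c_v)` lies in the bulk `{infDist(·, Eᶜ) ≥ η/2}` belongs to the jittered discrete domain
(conclusion of the transported honeycomb bulk lemma) and `0 ≤ δ`, `4δ ≤ η`, then at a vertex `w`
whose straight mesh point `δ · site w` has `infDist(·, Eᶜ) ≥ η` the jittered discrete domain has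
exactly the honeycomb bonds of `w`. [folklore] -/
theorem embDomainGraph_adj_iff_of_le_infDist {B : ℂ ≃ₜ ℂ}
    (hB : ∀ z : ℂ, B z = ((2 * z.re : ℝ) : ℂ) + ((2 / Real.sqrt 3 * z.im : ℝ) : ℂ) * Complex.I)
    {E : DobrushinDomain} {δ η : ℝ} (hδ : 0 ≤ δ) (hδη : 4 * δ ≤ η) (hη : 0 < η)
    (hbulk : ∀ v : HexVertex, η / 2 ≤ infDist ((δ : ℂ) * B (hexCenter v)) E.carrierᶜ →
      v ∈ SAW.embMeshDomain hexGraph (fun v => B (hexCenter v)) E.carrier δ)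
    {w : HexVertex}
    (hx : η ≤ infDist (meshPoint δ (![2 * w.1 0 + w.1 1 + ((w.2 : ℕ) : ℤ) + 1, w.1 1] : Site 2))
      E.carrierᶜ)
    (w' : HexVertex) :
    (SAW.embDomainGraph hexGraph (fun v => B (hexCenter v)) E.carrier δ).Adj w w' ↔
      hexGraph.Adj w w' := by
  refine ⟨fun h => SAW.embDomainGraph_le _ _ _ _ h, fun h => ?_⟩
  set p : ℂ := meshPoint δ (![2 * w.1 0 + w.1 1 + ((w.2 : ℕ) : ℤ) + 1, w.1 1] : Site 2) with hp
  have habs : |δ| = δ := abs_of_nonneg hδ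
  -- the jittered points of `w` and `w'` are within `2δ/3`, resp. `δ + 2δ/3`, of `p`
  have hw : dist ((δ : ℂ) * B (hexCenter w)) p ≤ 2 * δ / 3 := by
    rw [dist_comm]; simpa [habs] using dist_meshPoint_site_le hB δ w
  have hBW : SAW.brickWallGraph.Adj (![2 * w.1 0 + w.1 1 + ((w.2 : ℕ) : ℤ) + 1, w.1 1] : Site 2)
      (![2 * w'.1 0 + w'.1 1 + ((w'.2 : ℕ) : ℤ) + 1, w'.1 1] : Site 2) :=
    (hexGraph_adj_iff_brickWallGraph_adj w w').1 h
  have hw'site : dist (meshPoint δ (![2 * w'.1 0 + w'.1 1 + ((w'.2 : ℕ) : ℤ) + 1, w'.1 1] : Site 2))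
      p ≤ δ := by
    rw [hp, dist_comm, SquareTiling.dist_meshPoint_adj hδ (SAW.brickWallGraph_le hBW)]
  have hw' : dist ((δ : ℂ) * B (hexCenter w')) p ≤ δ + 2 * δ / 3 := by
    have h1 := dist_meshPoint_site_le hB δ w'
    rw [habs] at h1
    calc dist ((δ : ℂ) * B (hexCenter w')) p
        ≤ dist ((δ : ℂ) * B (hexCenter w'))
            (meshPoint δ (![2 * w'.1 0 + w'.1 1 + ((w'.2 : ℕ) : ℤ) + 1, w'.1 1] : Site 2)) +
          dist (meshPoint δ (![2 * w'.1 0 + w'.1 1 + ((w'.2 : ℕ) : ℤ) + 1, w'.1 1] : Site 2)) p :=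
          dist_triangle _ _ _
      _ ≤ 2 * δ / 3 + δ := by rw [dist_comm] at h1; exact add_le_add h1 hw'site
      _ = δ + 2 * δ / 3 := by ring
  refine (SAW.embDomainGraph_adj_iff _ _).2 ⟨(SAW.embMeshGraph_adj_iff _ _).2 ⟨h, ?_⟩, ?_, ?_⟩
  · exact segment_subset_closure_of_dist_lt hx (by linarith) (by linarith)
  · exact hbulk w (le_infDist_of_dist_le hx hw (by linarith))
  · exact hbulk w' (le_infDist_of_dist_le hx hw' (by linarith))

/-! ### The two bulk lemmas, in the form used here -/

/-- **`ℤ²` bulk lemma, collar form**: for small `δ > 0` every site whose mesh point is at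
distance `≥ η/2` from `Eᶜ` belongs to `meshDomain E δ`
(`JordanDomain.exists_forall_mem_meshDomain_and_reachable` with the compact
`{infDist(·, Eᶜ) ≥ η/2} ⊆ E`). [folklore] -/
theorem eventually_mem_meshDomain_of_le_infDist (E : DobrushinDomain) {η : ℝ} (hη : 0 < η) :
    ∀ᶠ δ in 𝓝[>] (0 : ℝ), ∀ y : Site 2, η / 2 ≤ infDist (meshPoint δ y) E.carrierᶜ →
      y ∈ meshDomain E.carrier δ := by
  obtain ⟨hK, hKE⟩ := isCompact_bulk E η hη
  obtain ⟨δ₀, hδ₀, h⟩ :=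
    E.toJordanDomain.exists_forall_mem_meshDomain_and_reachable hK hKE
  filter_upwards [Ioo_mem_nhdsGT hδ₀] with δ hδ
  exact fun y hy => (h δ hδ.1 hδ.2).1 y hy

/-- **Honeycomb bulk lemma, jittered collar form**: for small `δ > 0` every honeycomb vertex whose
JITTERED mesh point `δ B(c_v)` is at distance `≥ η/2` from `Eᶜ` belongs to the jittered discrete
domain `embMeshDomain hexGraph (B ∘ hexCenter) E δ` — the honeycomb bulk lemma
`HexEndpointApprox.exists_forall_mem_hexMeshDomain_and_reachable` for the Jordan domain `B⁻¹E` and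
the compact `B⁻¹{infDist(·, Eᶜ) ≥ η/2}`, transported by `embMeshDomain_affine`. [folklore] -/
theorem eventually_mem_embMeshDomain_of_le_infDist {B : ℂ ≃ₜ ℂ}
    (hB : ∀ z : ℂ, B z = ((2 * z.re : ℝ) : ℂ) + ((2 / Real.sqrt 3 * z.im : ℝ) : ℂ) * Complex.I)
    (E : DobrushinDomain) {η : ℝ} (hη : 0 < η) :
    ∀ᶠ δ : ℝ in 𝓝[>] (0 : ℝ), ∀ v : HexVertex, η / 2 ≤ infDist ((δ : ℂ) * B (hexCenter v)) E.carrierᶜ →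
      v ∈ SAW.embMeshDomain hexGraph (fun v => B (hexCenter v)) E.carrier δ := by
  obtain ⟨hK, hKE⟩ := isCompact_bulk E η hη
  have hBsmul := affinityB_real_mul hB
  have hBline := affinityB_lineMap hB
  set E' : JordanDomain := (E.map B.symm).toJordanDomain with hE'
  have hcar : E'.carrier = B.symm '' E.carrier := rfl
  have hK' : IsCompact (B.symm '' {z : ℂ | η / 2 ≤ infDist z E.carrierᶜ}) :=
    hK.image B.symm.continuous
  have hK'E : B.symm '' {z : ℂ | η / 2 ≤ infDist z E.carrierᶜ} ⊆ E'.carrier := by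
    rw [hcar]; exact image_mono hKE
  obtain ⟨δ₀, hδ₀, h⟩ :=
    Summit.CriticalPhenomena.SAWScalingLimit.Theorems.HexEndpointApprox.exists_forall_mem_hexMeshDomain_and_reachable
      E' hK' hK'E
  filter_upwards [Ioo_mem_nhdsGT hδ₀] with δ hδ
  intro v hv
  have hmem : (δ : ℂ) * hexCenter v ∈ B.symm '' {z : ℂ | η / 2 ≤ infDist z E.carrierᶜ} :=
    ⟨(δ : ℂ) * B (hexCenter v), hv, by rw [← hBsmul, B.symm_apply_apply]⟩
  have h1 := (h δ hδ.1 hδ.2).1 v hmem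
  rwa [hcar, embMeshDomain_affine hexGraph hexCenter B hBsmul hBline E.carrier δ] at h1

/-! ### The registered stub: the collar lemma -/

/-- **STUB (provable, reshape 5) — `stub_disputedCollar`, literal registered signature: disputed
sites live in an `o(1)`-collar of `∂E`.**  For `B = diag(2, 2/√3)`, every Dobrushin `E` and every
`η > 0`, eventually as `δ → 0⁺`: if the brick-wall site `x = site w = (2w₀ + w₁ + k + 1, w₁)` of a
honeycomb vertex `w` has, for some `w'`, an adjacency to `site w'` in
`discreteDomainGraph E δ ⊓ SAW.brickWallGraph` differing from the adjacency of `w, w'` in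
`SAW.embDomainGraph hexGraph (B ∘ hexCenter) E δ`, then `infDist(δx, Eᶜ) < η`.  Proof: otherwise
both adjacencies equal the plain lattice adjacency (`adj_inf_brickWall_iff_of_le_infDist`,
`embDomainGraph_adj_iff_of_le_infDist`, fed by the two bulk lemmas), and those agree by the
dictionary `hexGraph_adj_iff_brickWallGraph_adj`. [folklore] -/
theorem stub_disputedCollar : ∀ B : ℂ ≃ₜ ℂ, (∀ z : ℂ, B z = ((2 * z.re : ℝ) : ℂ) + ((2 / Real.sqrt 3 * z.im : ℝ) : ℂ) * Complex.I) → ∀ (E : DobrushinDomain) (η : ℝ), 0 < η → ∀ᶠ δ in nhdsWithin 0 (Set.Ioi 0), ∀ x : Site 2, (∃ w w' : HexVertex, ![2 * w.1 0 + w.1 1 + ((w.2 : ℕ) : ℤ) + 1, w.1 1] = x ∧ ¬ ((discreteDomainGraph E.carrier δ ⊓ SAW.brickWallGraph).Adj x ![2 * w'.1 0 + w'.1 1 + ((w'.2 : ℕ) : ℤ) + 1, w'.1 1] ↔ (SAW.embDomainGraph hexGraph (fun v => B (hexCenter v)) E.carrier δ).Adj w w')) → Metric.infDist (meshPoint δ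 x) E.carrierᶜ < η := by
  intro B hB E η hη
  have hδsmall : ∀ᶠ δ in 𝓝[>] (0 : ℝ), 0 < δ ∧ 4 * δ ≤ η := by
    filter_upwards [Ioo_mem_nhdsGT (show (0 : ℝ) < η / 4 by positivity)] with δ hδ
    exact ⟨hδ.1, by linarith [hδ.2]⟩
  filter_upwards [hδsmall, eventually_mem_meshDomain_of_le_infDist E hη,
    eventually_mem_embMeshDomain_of_le_infDist hB E hη] with δ hδ hZ hH
  rintro x ⟨w, w', rfl, hne⟩
  by_contra hfar
  push Not at hfar
  apply hne
  rw [adj_inf_brickWall_iff_of_le_infDist hδ.1.le (by linarith [hδ.2]) hη hZ hfar,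
    embDomainGraph_adj_iff_of_le_infDist hB hδ.1.le hδ.2 hη hH hfar,
    hexGraph_adj_iff_brickWallGraph_adj]

/-! ### From single-law boundary avoidance to the former stub M2a -/

/-- `ε`-management: eventual bounds by `ENNReal.ofReal ε` for every real `ε > 0` give convergence
to `0` in `ℝ≥0∞`. [folklore] -/
theorem tendsto_zero_of_forall_eventually_le_ofReal {ι : Type*} {l : Filter ι} {f : ι → ℝ≥0∞}
    (h : ∀ ε : ℝ, 0 < ε → ∀ᶠ i in l, f i ≤ ENNReal.ofReal ε) : Tendsto f l (𝓝 0) := by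
  rw [ENNReal.tendsto_nhds_zero]
  intro ε hε
  rcases eq_or_ne ε ⊤ with rfl | hε'
  · exact Eventually.of_forall fun _ => le_top
  · filter_upwards [h ε.toReal (ENNReal.toReal_pos hε.ne' hε')] with i hi
    rwa [ENNReal.ofReal_toReal hε'] at hi

/-- **(BA_bw) ∧ (BA_jhex) ⇒ (M2a).**  Single-law BOUNDARY AVOIDANCE away from the marked points —
for the straight brick-wall law with `ℤ²` conventions (`BA_bw`: for every `ρ, ε > 0` some collar
width `η > 0` is visited at distance `≥ ρ` from both marked points with probability `≤ ε`,
eventually in `δ`) and for the jittered honeycomb law read on brick-wall sites (`BA_jhex`) — implies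
the former registered stub M2a `stub_collarNonHitting` (disputed-collar non-hitting under both
laws): by the collar lemma `stub_disputedCollar` the far disputed sites eventually lie in the
`η`-collar, so the disputed-visit event is contained in the collar-visit event. [folklore] -/
theorem collarNonHitting_of_boundaryAvoidance
    (hBW : ∀ (E : DobrushinDomain) (a b : ℝ → Site 2), SAW.IsEndpointApprox E a b → ∀ ρ : ℝ, 0 < ρ → ∀ ε : ℝ, 0 < ε → ∃ η : ℝ, 0 < η ∧ ∀ᶠ δ in nhdsWithin 0 (Set.Ioi 0), SAW.brickWallLaw E.carrier δ 0 (a δ) (b δ) {γ | ∃ x ∈ γ.walk.support, Metric.infDist (meshPoint δ x) E.carrierᶜ < η ∧ ∀ i, ρ ≤ dist (meshPoint δ x) (E.pt i)} ≤ ENNReal.ofReal ε)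
    (hJ : ∀ B : ℂ ≃ₜ ℂ, (∀ z : ℂ, B z = ((2 * z.re : ℝ) : ℂ) + ((2 / Real.sqrt 3 * z.im : ℝ) : ℂ) * Complex.I) → ∀ (E : DobrushinDomain) (a' b' : ℝ → HexVertex), SAW.IsEmbEndpointApprox hexGraph (fun v => B (hexCenter v)) E a' b' → ∀ ρ : ℝ, 0 < ρ → ∀ ε : ℝ, 0 < ε → ∃ η : ℝ, 0 < η ∧ ∀ᶠ δ in nhdsWithin 0 (Set.Ioi 0), SAW.embLaw hexGraph (fun v => B (hexCenter v)) E.carrier δ SAW.hexCriticalFugacity (a' δ) (b' δ) {γ | ∃ x ∈ γ.walk.support.map fun w : HexVertex => (![2 * w.1 0 + w.1 1 + ((w.2 : ℕ) : ℤ) + 1, w.1 1] : Site 2), Metric.infDist (meshPoint δ x) E.carrierᶜ < η ∧ ∀ i, ρ ≤ dist (meshPoint δ x) (E.pt i)} ≤ ENNReal.ofReal ε) :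
    ∀ B : ℂ ≃ₜ ℂ, (∀ z : ℂ, B z = ((2 * z.re : ℝ) : ℂ) + ((2 / Real.sqrt 3 * z.im : ℝ) : ℂ) * Complex.I) → ∀ (E : DobrushinDomain) (a b : ℝ → Site 2) (a' b' : ℝ → HexVertex), SAW.IsEndpointApprox E a b → SAW.IsEmbEndpointApprox hexGraph (fun v => B (hexCenter v)) E a' b' → ∀ ρ : ℝ, 0 < ρ → Tendsto (fun δ => SAW.brickWallLaw E.carrier δ 0 (a δ) (b δ) {γ | ∃ x ∈ γ.walk.support, (∃ w w' : HexVertex, ![2 * w.1 0 + w.1 1 + ((w.2 : ℕ) : ℤ) + 1, w.1 1] = x ∧ ¬ ((discreteDomainGraph E.carrier δ ⊓ SAW.brickWallGraph).Adj x ![2 * w'.1 0 + w'.1 1 + ((w'.2 : ℕ) : ℤ) + 1, w'.1 1] ↔ (SAW.embDomainGraph hexGraph (fun v => B (hexCenter v)) E.carrier δ).Adj w w')) ∧ ∀ i, ρ ≤ dist (meshPoint δ x) (E.pt i)}) (nhdsWithin 0 (Set.Ioi 0)) (nhds 0) ∧ Tendsto (fun δ => SAW.embLaw hexGraph (fun v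 => B (hexCenter v)) E.carrier δ SAW.hexCriticalFugacity (a' δ) (b' δ) {γ | ∃ x ∈ γ.walk.support.map fun w : HexVertex => (![2 * w.1 0 + w.1 1 + ((w.2 : ℕ) : ℤ) + 1, w.1 1] : Site 2), (∃ w w' : HexVertex, ![2 * w.1 0 + w.1 1 + ((w.2 : ℕ) : ℤ) + 1, w.1 1] = x ∧ ¬ ((discreteDomainGraph E.carrier δ ⊓ SAW.brickWallGraph).Adj x ![2 * w'.1 0 + w'.1 1 + ((w'.2 : ℕ) : ℤ) + 1, w'.1 1] ↔ (SAW.embDomainGraph hexGraph (fun v => B (hexCenter v)) E.carrier δ).Adj w w')) ∧ ∀ i, ρ ≤ dist (meshPoint δ x) (E.pt i)}) (nhdsWithin 0 (Set.Ioi 0)) (nhds 0) := by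
  intro B hB E a b a' b' hab hab' ρ hρ
  constructor
  · refine tendsto_zero_of_forall_eventually_le_ofReal fun ε hε => ?_
    obtain ⟨η, hη, hev⟩ := hBW E a b hab ρ hρ ε hε
    filter_upwards [hev, stub_disputedCollar B hB E η hη] with δ h1 h2
    refine le_trans (measure_mono ?_) h1
    rintro γ ⟨x, hx, hdisp, hfar⟩
    exact ⟨x, hx, h2 x hdisp, hfar⟩
  · refine tendsto_zero_of_forall_eventually_le_ofReal fun ε hε => ?_
    obtain ⟨η, hη, hev⟩ := hJ B hB E a' b' hab' ρ hρ ε hε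
    filter_upwards [hev, stub_disputedCollar B hB E η hη] with δ h1 h2
    refine le_trans (measure_mono ?_) h1
    rintro γ ⟨x, hx, hdisp, hfar⟩
    exact ⟨x, hx, h2 x hdisp, hfar⟩

end Summit.CriticalPhenomena.SAWScalingLimit.Cruxes.ModulusUniversality.Birth

end
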